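import Summits.ValiantsHypothesis.ValiantsHypothesis.Theorems.KPlusLogSqLawValuativeDoorVirtual
import Summits.ValiantsHypothesis.ValiantsHypothesis.Theorems.KPlusLogSqLawValuativeDoorDominantClasses

/-!
# LINE `valuative_door` (crux `WeakLifting`, stmt-ValiantsHypothesis-19561) — CANCELLATION-FREE PENCILS obey the polynomial valuative law
# `npEdges ≤ m (K − 1)` for ALL exponent vectors; in particular nonnegative-scalar (PSD rank-one) pencils over ORDERED non-archimedean fields

HONEST FRAMING.  Helper (cell `pub-symmetroid`, seat val-sym-lift-p1 g22, 2026-08-29; `--supports 19561 --as helper`).  By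
`…ValuativeDoorRankOneLawToMDR`, a polynomial valuative bound for ALL rank-one lacunary pencils (repeated exponents allowed) would already give
`ValMatrixDescartes` and, through the line's kernel door, the summit; by `…ValuativeDoorDominantClasses`, the VIRTUAL count (classes of the
Cauchy–Binet terms `w_S = ε(S) det(u_S)²`) IS polynomial for all `d`.  This file makes the gap explicit: the only thing that can separate the
actual coefficient `c_E = Σ_{E(S)=E} w_S` from the virtual picture is IN-CLASS CANCELLATION.  THEOREM (`domCount_le_of_cancellationFree`):
if no class sum is smaller in `v` than any of its terms (`v(w_S) ≤ v(c_{E(S)})` for all `m`-sets `S`), then `npEdges ≤ m (K − 1)` for every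
`d` (repeats allowed), every `u`, non-archimedean `v`.  COROLLARY (`npEdges_le_of_nonneg_scalars_ordered`): over an ORDERED field with an
order-convex non-archimedean absolute value (`0 ≤ a ≤ b ⇒ v a ≤ v b`; e.g. Puiseux/Hahn series, any non-archimedean real closed field with its
natural valuation), rank-one pencils with NONNEGATIVE scalars `ε_l ≥ 0` — i.e. positive semidefinite rank-one letters, equivalently (by
`exists_eq_sum_smul_vecMulVec`-type decompositions) PSD letters of any rank — are cancellation-free, hence obey `npEdges ≤ m (K − 1)`
unconditionally.  So the summit-strength content of the valuative programme lives entirely in SIGNED cancellation (indefinite letters, or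
absolute values incompatible with any ordering such as the 2-adic one on `ℝ` used by the door).  Calibration-class; closes nothing; no bearing on
vW / vB as stated, `TropicalB`, `MatrixDescartes` (18050) or VP ≠ VNP.  [elementary]
-/

set_option linter.dupNamespace false
set_option autoImplicit false

namespace Summit.ValiantsHypothesis.ValiantsHypothesis.Theorems.KPlusLogSqLaw.ValDoor

open Polynomial Finset Matrix
open scoped BigOperators Classical

/-! ## §1 Cancellation-free pencils -/

/-- **CANCELLATION-FREE ⇒ FEW DOMINANT EXPONENTS (any `d`, repeats allowed):** if every virtual coefficient is bounded in `v` by the actual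
coefficient of its class, the rank-one lacunary determinant has at most `m (K − 1) + 1` dominant exponents.  [assembly: `exchange_virtual`,
`coeff_eq_sum_virtual`, `card_dominantClasses_le`] -/
theorem domCount_le_of_cancellationFree {F : Type*} [Field F] (v : AbsoluteValue F ℝ) (hv : IsNonarchimedean v) (m K : ℕ)
    (d : Fin K → ℕ) (ε : Fin K → F) (u : Fin K → Fin m → F)
    (hcf : ∀ S : Finset (Fin K), S.card = m →
      v (∑ t ∈ (univ : Finset (Fin m → Fin K)).filter (fun t => StrictMono t ∧ univ.image t = S),
          (∏ i, ε (t i)) * (Matrix.det (Matrix.of fun i j => u (t j) i)) ^ 2)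
        ≤ v ((Matrix.det (∑ l, ((X : F[X]) ^ d l) • (ε l • Matrix.vecMulVec (u l) (u l)).map (C : F →+* F[X]))).coeff
            (∑ l ∈ S, d l))) :
    ((Matrix.det (∑ l, ((X : F[X]) ^ d l) • (ε l • Matrix.vecMulVec (u l) (u l)).map (C : F →+* F[X]))).support.filter
        fun E => ∃ r : ℝ, 0 < r ∧
          ∀ E' ∈ (Matrix.det (∑ l, ((X : F[X]) ^ d l) • (ε l • Matrix.vecMulVec (u l) (u l)).map (C : F →+* F[X]))).support,
            E' ≠ E →
            v ((Matrix.det (∑ l, ((X : F[X]) ^ d l) • (ε l • Matrix.vecMulVec (u l) (u l)).map (C : F →+* F[X]))).coeff E') * r ^ E'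
              < v ((Matrix.det (∑ l, ((X : F[X]) ^ d l) • (ε l • Matrix.vecMulVec (u l) (u l)).map (C : F →+* F[X]))).coeff E) * r ^ E).card
      ≤ m * (K - 1) + 1 := by
  set f : F[X] := Matrix.det (∑ l, ((X : F[X]) ^ d l) • (ε l • Matrix.vecMulVec (u l) (u l)).map (C : F →+* F[X])) with hf
  set D := f.support.filter fun E => ∃ r : ℝ, 0 < r ∧ ∀ E' ∈ f.support, E' ≠ E →
      v (f.coeff E') * r ^ E' < v (f.coeff E) * r ^ E with hD
  set W : Finset (Fin K) → F := fun S => ∑ t ∈ (univ : Finset (Fin m → Fin K)).filter (fun t => StrictMono t ∧ univ.image t = S),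
      (∏ i, ε (t i)) * (Matrix.det (Matrix.of fun i j => u (t j) i)) ^ 2 with hW
  set 𝒮 : Finset (Finset (Fin K)) := univ.filter fun S => S.card = m ∧ W S ≠ 0 with h𝒮
  set a : Finset (Fin K) → ℝ := fun S => Real.log (v (W S)) with ha
  have h𝒮mem : ∀ {S : Finset (Fin K)}, S ∈ 𝒮 ↔ S.card = m ∧ W S ≠ 0 := by
    intro S
    rw [h𝒮, Finset.mem_filter]
    exact ⟨fun h => h.2, fun h => ⟨Finset.mem_univ _, h⟩⟩
  have hcard : ∀ S ∈ 𝒮, S.card = m := fun S hS => (h𝒮mem.1 hS).1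
  have hWpos : ∀ S ∈ 𝒮, 0 < v (W S) := fun S hS => v.pos (h𝒮mem.1 hS).2
  have hX : ∀ A ∈ 𝒮, ∀ B ∈ 𝒮, ∀ i ∈ A \ B, ∃ j ∈ B \ A, insert j (A.erase i) ∈ 𝒮 ∧ insert i (B.erase j) ∈ 𝒮 ∧
      a A + a B ≤ a (insert j (A.erase i)) + a (insert i (B.erase j)) := by
    intro A hA B hB i hi
    obtain ⟨hAc, hA0⟩ := h𝒮mem.1 hA
    obtain ⟨hBc, hB0⟩ := h𝒮mem.1 hB
    obtain ⟨j, hj, hle⟩ := exchange_virtual v hv m K ε u A B hAc hBc hA0 hB0 i hi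
    change v (W A) * v (W B) ≤ v (W (insert j (A.erase i))) * v (W (insert i (B.erase j))) at hle
    obtain ⟨hiA, hiB⟩ := Finset.mem_sdiff.1 hi
    obtain ⟨hjB, hjA⟩ := Finset.mem_sdiff.1 hj
    have hposA := hWpos A hA
    have hposB := hWpos B hB
    have hpos : 0 < v (W (insert j (A.erase i))) * v (W (insert i (B.erase j))) := lt_of_lt_of_le (mul_pos hposA hposB) hle
    have hposA' : 0 < v (W (insert j (A.erase i))) :=
      lt_of_le_of_ne (v.nonneg _) fun h => by rw [← h, zero_mul] at hpos; exact lt_irrefl _ hpos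
    have hposB' : 0 < v (W (insert i (B.erase j))) :=
      lt_of_le_of_ne (v.nonneg _) fun h => by rw [← h, mul_zero] at hpos; exact lt_irrefl _ hpos
    refine ⟨j, hj, h𝒮mem.2 ⟨?_, (v.pos_iff).1 hposA'⟩, h𝒮mem.2 ⟨?_, (v.pos_iff).1 hposB'⟩, ?_⟩
    · rw [card_exchange hiA hjA, hAc]
    · rw [card_exchange hjB hiB, hBc]
    · have h1 := Real.log_le_log (mul_pos hposA hposB) hle
      rw [Real.log_mul hposA.ne' hposB.ne', Real.log_mul hposA'.ne' hposB'.ne'] at h1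
      exact h1
  have hcoeff : ∀ E : ℕ, f.coeff E = ∑ S ∈ (univ : Finset (Finset (Fin K))).filter (fun S => S.card = m ∧ ∑ l ∈ S, d l = E), W S :=
    fun E => coeff_eq_sum_virtual m K d ε u E
  -- every actual coefficient is bounded by a supported virtual one of its class
  have hbound : ∀ E ∈ f.support, ∃ S ∈ 𝒮, ∑ l ∈ S, d l = E ∧ v (f.coeff E) ≤ v (W S) := by
    intro E hE
    have hne0 := Polynomial.mem_support_iff.1 hE
    rw [hcoeff E] at hne0 ⊢
    have hCne : ((univ : Finset (Finset (Fin K))).filter (fun S => S.card = m ∧ ∑ l ∈ S, d l = E)).Nonempty := by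
      rw [Finset.nonempty_iff_ne_empty]
      intro h
      rw [h, Finset.sum_empty] at hne0
      exact hne0 rfl
    obtain ⟨S, hS, hle⟩ := IsNonarchimedean.finset_image_add_of_nonempty hv W hCne
    obtain ⟨-, hSc, hSE⟩ := Finset.mem_filter.1 hS
    have hWS : W S ≠ 0 := by
      intro h0
      rw [h0, map_zero] at hle
      exact hne0 ((AbsoluteValue.eq_zero v).1 (le_antisymm hle (v.nonneg _)))
    exact ⟨S, h𝒮mem.2 ⟨hSc, hWS⟩, hSE, hle⟩
  -- each dominant exponent is an on-top class, witnessed by the class maximiser of `a`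
  have key : ∀ E ∈ D, ∃ S ∈ 𝒮, ∑ l ∈ S, d l = E ∧ ∃ t : ℝ,
      (∀ T ∈ 𝒮, a T + t * ((∑ l ∈ T, d l : ℕ) : ℝ) ≤ a S + t * ((∑ l ∈ S, d l : ℕ) : ℝ)) ∧
      (∀ T ∈ 𝒮, ∑ l ∈ T, d l ≠ ∑ l ∈ S, d l → a T + t * ((∑ l ∈ T, d l : ℕ) : ℝ) < a S + t * ((∑ l ∈ S, d l : ℕ) : ℝ)) := by
    intro E hED
    obtain ⟨hEs, hdom⟩ := Finset.mem_filter.1 hED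
    obtain ⟨s, hs⟩ := (exists_dominant_iff_exists_slope v f hEs).1 hdom
    obtain ⟨S₀, hS₀, hS₀E, hS₀le⟩ := hbound E hEs
    -- the class maximiser
    obtain ⟨S, hS, hSmax⟩ := Finset.exists_max_image (𝒮.filter fun T => ∑ l ∈ T, d l = E) a
      ⟨S₀, Finset.mem_filter.2 ⟨hS₀, hS₀E⟩⟩
    obtain ⟨hS𝒮, hSE⟩ := Finset.mem_filter.1 hS
    have hcE : Real.log (v (f.coeff E)) ≤ a S :=
      (Real.log_le_log (v.pos (Polynomial.mem_support_iff.1 hEs)) hS₀le).trans (hSmax S₀ (Finset.mem_filter.2 ⟨hS₀, hS₀E⟩))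
    refine ⟨S, hS𝒮, hSE, s, fun T hT => ?_, fun T hT hTne => ?_⟩
    · by_cases hTE : ∑ l ∈ T, d l = ∑ l ∈ S, d l
      · have h1 := hSmax T (Finset.mem_filter.2 ⟨hT, hTE.trans hSE⟩)
        rw [hTE]
        linarith
      · -- another class: through the actual coefficients
        have hTc : v (W T) ≤ v (f.coeff (∑ l ∈ T, d l)) := hcf T (hcard T hT)
        have hT0 : f.coeff (∑ l ∈ T, d l) ≠ 0 := fun h0 => by
          rw [h0, map_zero] at hTc
          exact absurd hTc (not_le.2 (hWpos T hT))
        have hTs : (∑ l ∈ T, d l) ∈ f.support := Polynomial.mem_support_iff.2 hT0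
        have h1 := hs _ hTs (fun h => hTE (h.trans hSE.symm))
        have h2 : a T ≤ Real.log (v (f.coeff (∑ l ∈ T, d l))) := Real.log_le_log (hWpos T hT) hTc
        rw [hSE]
        have e1 : ((∑ l ∈ T, d l : ℕ) : ℝ) * s = s * ((∑ l ∈ T, d l : ℕ) : ℝ) := mul_comm _ _
        have e2 : (E : ℝ) * s = s * (E : ℝ) := mul_comm _ _
        rw [e1, e2] at h1
        linarith
    · have hTc : v (W T) ≤ v (f.coeff (∑ l ∈ T, d l)) := hcf T (hcard T hT)
      have hT0 : f.coeff (∑ l ∈ T, d l) ≠ 0 := fun h0 => by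
        rw [h0, map_zero] at hTc
        exact absurd hTc (not_le.2 (hWpos T hT))
      have hTs : (∑ l ∈ T, d l) ∈ f.support := Polynomial.mem_support_iff.2 hT0
      have h1 := hs _ hTs (fun h => hTne (h.trans hSE.symm))
      have h2 : a T ≤ Real.log (v (f.coeff (∑ l ∈ T, d l))) := Real.log_le_log (hWpos T hT) hTc
      rw [hSE]
      have e1 : ((∑ l ∈ T, d l : ℕ) : ℝ) * s = s * ((∑ l ∈ T, d l : ℕ) : ℝ) := mul_comm _ _
      have e2 : (E : ℝ) * s = s * (E : ℝ) := mul_comm _ _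
      rw [e1, e2] at h1
      linarith
  exact card_dominantClasses_le 𝒮 a d m hcard hX D key

/-! ## §2 Ordered fields: nonnegative scalars are cancellation-free -/

/-- **NONNEGATIVE-SCALAR (PSD rank-one) PENCILS OVER ORDERED NON-ARCHIMEDEAN FIELDS:** if `v` is order-convex (`0 ≤ a ≤ b ⇒ v a ≤ v b`) and
all `ε_l ≥ 0`, then for EVERY exponent vector `d` (repeats allowed) and all vectors `u`: `npEdges ≤ m (K − 1)` (unfolded).  The class sums are
sums of nonnegative terms, so no term exceeds the sum. [corollary of `domCount_le_of_cancellationFree`] -/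
theorem npEdges_le_of_nonneg_scalars_ordered :
    ∀ (F : Type) [Field F] [LinearOrder F] [IsOrderedRing F] (v : AbsoluteValue F ℝ), IsNonarchimedean v →
      (∀ a b : F, 0 ≤ a → a ≤ b → v a ≤ v b) →
      ∀ (m K : ℕ) (d : Fin K → ℕ) (ε : Fin K → F) (u : Fin K → Fin m → F), (∀ l, 0 ≤ ε l) →
        ((Matrix.det (∑ l, ((Polynomial.X : Polynomial F) ^ d l) •
            (ε l • Matrix.vecMulVec (u l) (u l)).map Polynomial.C)).support.filter fun E => ∃ r : ℝ, 0 < r ∧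
            ∀ E' ∈ (Matrix.det (∑ l, ((Polynomial.X : Polynomial F) ^ d l) •
              (ε l • Matrix.vecMulVec (u l) (u l)).map Polynomial.C)).support, E' ≠ E →
              v ((Matrix.det (∑ l, ((Polynomial.X : Polynomial F) ^ d l) •
                (ε l • Matrix.vecMulVec (u l) (u l)).map Polynomial.C)).coeff E') * r ^ E'
              < v ((Matrix.det (∑ l, ((Polynomial.X : Polynomial F) ^ d l) •
                (ε l • Matrix.vecMulVec (u l) (u l)).map Polynomial.C)).coeff E) * r ^ E).card - 1
          ≤ m * (K - 1) := by
  intro F _ _ _ v hv hmono m K d ε u hε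
  refine Nat.sub_le_iff_le_add.2 (domCount_le_of_cancellationFree v hv m K d ε u fun S hS => ?_)
  -- all virtual coefficients are nonnegative
  have hWnn : ∀ T : Finset (Fin K), 0 ≤ ∑ t ∈ (univ : Finset (Fin m → Fin K)).filter (fun t => StrictMono t ∧ univ.image t = T),
      (∏ i, ε (t i)) * (Matrix.det (Matrix.of fun i j => u (t j) i)) ^ 2 :=
    fun T => Finset.sum_nonneg fun t _ => mul_nonneg (Finset.prod_nonneg fun i _ => hε (t i)) (sq_nonneg _)
  refine hmono _ _ (hWnn S) ?_
  rw [coeff_eq_sum_virtual m K d ε u (∑ l ∈ S, d l)]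
  exact Finset.single_le_sum (fun T _ => hWnn T) (Finset.mem_filter.2 ⟨Finset.mem_univ _, hS, rfl⟩)

end Summit.ValiantsHypothesis.ValiantsHypothesis.Theorems.KPlusLogSqLaw.ValDoor
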